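import Summits.HodgeConjecture.HodgeConjecture.Theorems.Ring2HypothesesDescentMotivatedNumerical
import Summits.HodgeConjecture.HodgeConjecture.Theorems.Ring2HypothesesDescentMotivatedLefschetzComponents
import Literature.AlgebraicGeometry.HodgeTheory.AbsoluteHodgeClassesCupGysin
import HarnessLib

/-!
# Ring 2 — hypotheses layer, descent axis: THE CUP PAIRING IS NON-DEGENERATE ON ABSOLUTE HODGE CLASSES
# (the realisation-level content of Deligne–Milne 1982 II Prop. 6.5 «the category of motives for absolute Hodge
# cycles is semisimple», modulo the class-level facts of Deligne's §2 that the tree records by name)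

HONEST FRAMING (page 1, verbatim the cell's standing line): **research route conditional on HC_CM; not a
corollary; Q11.4-sentence-2 already refuted in dim ≥ 3.** Nothing in this file proves a case of the Hodge conjecture;
nothing discharges the binder of record b06 `Ring2.Hypotheses.AbsoluteHodgeImpliesAlgebraicAV` («absolute Hodge classes
on complex abelian varieties are algebraic», `Ring2HypothesesDescent.lean` :73; OPEN); the binder table's numbers do not
move. `HC_CM` (`Theses.RankFourFaces.CMAbelianHodge`) does not occur in this file; row b06 does not occur in this file.

Hodge ladder STAGE 3, `BINDER-OWNERS.md` row **b06**, seat `ring2-b06` (gen 76). Gens 73–75 reduced the row along the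
SHAPE axis by tools that DESCEND algebraicity (isogenies, subquotients, Jacobians, curve powers) — on the absolute road
only along EQUIDIMENSIONAL surjections (`f_* f^* = deg f`), the general surjection / domination case being reserved to
the Hodge road (Arapura 2006 Lemma 4.2, whose proof LIFTS a class through a correspondence by SEMISIMPLICITY of
polarisable Hodge structures) and to the motivic road (ring2-b05 gen 40: André's semisimplicity, Thm. 0.4 / Prop. 3.3).
The census of gen 75 names the missing tool: «an AH-version of Arapura 4.2 (semisimplicity of AH motives — not in the
tree)». In print that semisimplicity is Deligne–Milne 1982 (LNM 900, II «Tannakian categories») Prop. 6.5: the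
`ℚ`-linear category of motives for absolute Hodge cycles is semisimple Tannakian — because the Künneth projectors and
the Lefschetz operators `Λ`, `*` are absolute Hodge cycles (Deligne 1982 §2 Ex. 2.1 (b), (c)), so that the form
`ψ` built from `*` polarises it (II Prop. 6.2). THIS FILE proves the realisation-level statement the descent needs —
André's Prop. 3.3 with «motivé» replaced by «de Hodge absolu» — on the tree's real carriers, MODULO the class-level
facts of Deligne's §2 that the tree records BY NAME (lane lit-hodgefound; none is new here, none is discharged here):

* (V-B3) `deligne1982_cycleClass_absoluteHodge` — Ex. 2.1 (a): rational algebraic classes are absolute Hodge;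
* (T1c) `deligne1982_lefschetz_absoluteHodge_iff` — Ex. 2.1 (c): `*_L` preserves and detects absolute Hodge classes;
* (CS7) `deligne1982_cupProduct_absoluteHodge` — Charles–Schnell Prop. 11.2.7 (1) / Deligne Ex. 2.3: cup products.

With `S^p(X) := span_ℂ {c ∈ H^{2p}(X(ℂ); ℂ) | IsAbsoluteHodgeClass n X p c}` (written inline throughout; no definition):

* §1 `S^p(X)` is stable under complex conjugation (absolute Hodge classes are RATIONAL, hence real) and lies in the
  Hodge span `span_ℂ Hdg^p(X)` (they are of type `(p,p)`) — fact-free.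
* §2 `Lʲ S^l(X) ⊆ S^{l+j}(X)` for every polarisation class `η` (mod V-B3 + CS7: `η` is rational algebraic, hence
  absolute Hodge, and `η ∪ ·` preserves absolute Hodge classes) and `*_η S^e(X) ⊆ S^{e'}(X)` (mod T1c).
* §3 **`lefschetzPowTo_primitivePart_mem_span_absoluteHodge` — the Lefschetz (primitive) components of a class of
  `S(X)` lie in `S(X)`** (mod V-B3 + T1c + CS7): they lie in the span of the one-star sandwiches `Lᵃ *_η Lᶜ x`
  (ring2-b05 gen 35's GENERIC `lefschetzComponent_mem_sandwichSpan`, André Prop. 2.2 Cor. 2 mechanism).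
* §4 **`eq_zero_of_forall_cupProduct_absoluteHodge_eq_zero` — NON-DEGENERACY: for `X` smooth projective of dimension
  `n`, `p + q = n`, a class `ξ ∈ S^p(X)` cup-orthogonal to `S^q(X)` vanishes** (mod V-B3 + T1c + CS7). Proof = André's
  Prop. 3.3 / ring2-b05 gen 36 verbatim with `A_mot` replaced by `S`: `Q_D(conj ξ, ·) = τ(z ∪ ·)` with `z` built from
  the Lefschetz components of `conj ξ ∈ S^p` (§1, §3), hence `z ∈ S^q`, so `Q_D(conj ξ, ξ) = ± τ(ξ ∪ z) = 0` and
  `ξ = 0` by the second Hodge–Riemann relation on pure type `(p,p)` (the tree's `KaehlerRationalDatum.cform_conj_pos`).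
  Packaged two-sided: `nondegenerate_span_absoluteHodge`; generator form `eq_zero_of_forall_cupProduct_isAbsoluteHodgeClass_eq_zero`.

WHY IT IS WORTH A LINE. This is the engine of the companion `Ring2HypothesesDescentAbsoluteCorrespondenceLift` (same
gen): absolute Hodge classes LIFT through algebraic correspondences, hence «absolute Hodge ⟹ algebraic» DESCENDS along
Arapura's domination by powers and along ARBITRARY surjections — which removes Deligne's Main Theorem 2.11 (fact c1)
from gen 75's curve-power form of row b06 and closes the «equidimensional only» gap of gen 73.

HONEST COLUMN. Nothing is discharged; row b06 does not occur; V-B3, T1c, CS7 are named facts OF RECORD occurring only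
as displayed hypotheses `hZ`, `hL`, `hcup`; no definition, no new named fact, no sorry. NOT obtained: the statement for
the `ℚ`-structure of absolute Hodge classes themselves (additivity of `IsAbsoluteHodgeClass` is only known modulo (N)
`chartConjugation_canonical` + (E); the `ℂ`-span formulation avoids it), `dim S^p = dim S^{n-p}`, anything categorical
(no category of motives in the tree), the `ℓ`-adic components of Deligne's notion.

PRESEARCH: «absolute Hodge cycles semisimple category / numerical equals homological for absolute Hodge» →
[corpus: Deligne–Milne 1982 LNM 900 II §6 Prop. 6.5 (re-edition `paper:galaxy-pdf-8405055998839152860` neighbourhood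
of II 6.1–6.2, the lane's cited chunks p0062)] semisimplicity via polarisation; [corpus: `paper:doi-10-1007-bf02698643`
André 1996 Prop. 3.3 pp. 21–22] the motivated twin; Charles–Schnell 2014 §11.2.3–11.2.5 (Prop. 11.2.7–11.2.8, 11.2.18);
no printed statement of §4 on the real carriers in this form — certification by assembly, no novelty in print claimed.

References (bib keys): DeligneMilne1982Tannakian (II Prop. 6.1, 6.2, 6.5), Deligne1982HodgeCycles (§2 Ex. 2.1 (a)–(c),
Ex. 2.3, pp. 15–16), Andre1996Motifs (Prop. 2.2 Cor. 1–2 p. 16, Prop. 3.3 pp. 21–22), CharlesSchnell2014Notes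
(Def. 11.2.3, Prop. 11.2.7–11.2.8, 11.2.18), Kleiman1968AlgebraicCycles (§1.4, §3 Prop. 3.8), VoisinHodgeI2002
(§6.2.3 Cor. 6.26, §6.3.2 Thm. 6.32, §7.1.2).
-/

noncomputable section

set_option linter.dupNamespace false

open CategoryTheory AlgebraicGeometry MonoidalCategory CartesianMonoidalCategory
open Literature.AlgebraicTopology.SingularHomology Literature.Geometry.Kaehler
open Literature.AlgebraicGeometry Literature.AlgebraicGeometry.Motives
open Literature.AlgebraicGeometry.HodgeTheory
open Summit.HodgeConjecture.HodgeConjecture.Theorems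

namespace Summit.HodgeConjecture.HodgeConjecture.Ring2.Hypotheses

variable {n : ℕ} {X : SchemeOver ℂ} {η : complexBetti X 2}

/-! ## §1 The `ℂ`-span of the absolute Hodge classes: conjugation-stable, inside the Hodge span (fact-free) -/

/-- **`S^p(X) = span_ℂ AH^p(X)` is stable under complex conjugation**: absolute Hodge classes are rational
(`IsAbsoluteHodgeClass.isRationalClass`), hence fixed by conjugation, and conjugation is conjugate-linear.
[cite: CharlesSchnell2014Notes, Def. 11.2.3] [cite: VoisinHodgeI2002, Cor. 6.12] -/
theorem conjClass_mem_span_absoluteHodge (p : ℕ) {c : complexBetti X (2 * p)}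
    (hc : c ∈ Submodule.span ℂ {c : complexBetti X (2 * p) | IsAbsoluteHodgeClass n X p c}) :
    conjClass (ComplexPoints X) (2 * p) c ∈
      Submodule.span ℂ {c : complexBetti X (2 * p) | IsAbsoluteHodgeClass n X p c} := by
  induction hc using Submodule.span_induction with
  | mem c hmem => rw [hmem.isRationalClass.conjClass_eq]; exact Submodule.subset_span hmem
  | zero => rw [conjClass_zero]; exact Submodule.zero_mem _
  | add c c' _ _ ihc ihc' => rw [conjClass_add]; exact Submodule.add_mem _ ihc ihc'
  | smul a c _ ihc => rw [conjClass_smul]; exact Submodule.smul_mem _ _ ihc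

/-- **`S^p(X)` lies in the Hodge span** `span_ℂ {c | c rational of type (p,p)}` ("taking `σ = id`, absolute Hodge
classes are Hodge classes"). [cite: CharlesSchnell2014Notes, Def. 11.2.3] -/
theorem span_absoluteHodge_le_span_hodge (p : ℕ) :
    Submodule.span ℂ {c : complexBetti X (2 * p) | IsAbsoluteHodgeClass n X p c} ≤
      Submodule.span ℂ {c : complexBetti X (2 * p) | IsRationalClass c ∧ IsOfHodgeType n X (2 * p) p p c} :=
  Submodule.span_mono fun _ hc ↦ ⟨hc.isRationalClass, hc.isOfHodgeType⟩

/-! ## §2 Lefschetz powers and the Lefschetz involution preserve the span (mod V-B3 + CS7, resp. T1c) -/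

/-- **`Lʲ` preserves absolute Hodge classes** for a polarisation class `η` (mod V-B3 + CS7): `η` is a rational
algebraic class, hence absolute Hodge (Ex. 2.1 (a)), and `η ∪ ·` preserves absolute Hodge classes (Charles–Schnell
11.2.7 (1)); iterate (`L c = η ∪ c`). [cite: Deligne1982HodgeCycles, §2 Example 2.1 (a) and the sentence following (c) (p. 16)]
[cite: CharlesSchnell2014Notes, Prop. 11.2.7 (1)] -/
theorem isAbsoluteHodgeClass_lefschetzPowTo (hZ : deligne1982_cycleClass_absoluteHodge)
    (hcup : deligne1982_cupProduct_absoluteHodge) (hX : IsSmoothProjective n X) (hη : IsPolarizationClass n X η) :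
    ∀ (j l : ℕ) (hm : 2 * l + 2 * j = 2 * (l + j)) {c : complexBetti X (2 * l)},
      IsAbsoluteHodgeClass n X l c → IsAbsoluteHodgeClass n X (l + j) (lefschetzPowTo η j (2 * l) (2 * (l + j)) hm c)
  | 0, l, hm, c, hc => by
    have h0 : lefschetzPowTo η 0 (2 * l) (2 * (l + 0)) hm c = c := rfl
    rw [h0]
    exact hc
  | j + 1, l, hm, c, hc => by
    rw [lefschetzPowTo_succ_apply η j (2 * l) (2 * (l + j)) (2 * (l + (j + 1))) (by omega) hm (by omega),
      lefschetzOperator_apply]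
    have ih := isAbsoluteHodgeClass_lefschetzPowTo hZ hcup hX hη j l (by omega) hc
    have hηAH : IsAbsoluteHodgeClass n X 1 η := hZ hX 1 η hη.isRationalClass hη.mem_algebraicClasses
    exact hcup.cup hX (show 1 + (l + j) = l + (j + 1) by omega)
      (show 2 * 1 + 2 * (l + j) = 2 * (l + (j + 1)) by omega) hηAH ih

/-- `Lʲ AH^l(X) ⊆ AH^r(X)`, `2l + 2j = 2r` (free spelling of the target codimension).
[cite: Deligne1982HodgeCycles, §2 Example 2.1 (a), (c) (p. 16)] [cite: CharlesSchnell2014Notes, Prop. 11.2.7 (1)] -/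
theorem isAbsoluteHodgeClass_lefschetzPowTo' (hZ : deligne1982_cycleClass_absoluteHodge)
    (hcup : deligne1982_cupProduct_absoluteHodge) (hX : IsSmoothProjective n X) (hη : IsPolarizationClass n X η)
    (j l : ℕ) {r : ℕ} (hm : 2 * l + 2 * j = 2 * r) {c : complexBetti X (2 * l)} (hc : IsAbsoluteHodgeClass n X l c) :
    IsAbsoluteHodgeClass n X r (lefschetzPowTo η j (2 * l) (2 * r) hm c) := by
  obtain rfl : r = l + j := by omega
  exact isAbsoluteHodgeClass_lefschetzPowTo hZ hcup hX hη j l hm hc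

/-- **`Lʲ S^l(X) ⊆ S^r(X)`** (`2l + 2j = 2r`): the span form (`Lʲ` is linear). [cite: Deligne1982HodgeCycles, §2 Example 2.1 (a), (c) (p. 16)]
[cite: CharlesSchnell2014Notes, Prop. 11.2.7 (1)] -/
theorem lefschetzPowTo_mem_span_absoluteHodge (hZ : deligne1982_cycleClass_absoluteHodge)
    (hcup : deligne1982_cupProduct_absoluteHodge) (hX : IsSmoothProjective n X) (hη : IsPolarizationClass n X η)
    (j l : ℕ) {r : ℕ} (hm : 2 * l + 2 * j = 2 * r) {c : complexBetti X (2 * l)}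
    (hc : c ∈ Submodule.span ℂ {c : complexBetti X (2 * l) | IsAbsoluteHodgeClass n X l c}) :
    lefschetzPowTo η j (2 * l) (2 * r) hm c ∈
      Submodule.span ℂ {c : complexBetti X (2 * r) | IsAbsoluteHodgeClass n X r c} := by
  induction hc using Submodule.span_induction with
  | mem c hmem => exact Submodule.subset_span (isAbsoluteHodgeClass_lefschetzPowTo' hZ hcup hX hη j l hm hmem)
  | zero => rw [map_zero]; exact Submodule.zero_mem _
  | add c c' _ _ ihc ihc' => rw [map_add]; exact Submodule.add_mem _ ihc ihc'
  | smul a c _ ihc => rw [map_smul]; exact Submodule.smul_mem _ _ ihc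

/-- **`*_η S^e(X) ⊆ S^{e'}(X)`**, `2e + 2e' = 2n` (mod T1c: André's `*_L` preserves absolute Hodge classes, Deligne's
Ex. 2.1 (c) in the `*_L`-form `deligne1982_lefschetz_absoluteHodge_iff.lefschetzInvolution_iff`; `*_η` is linear).
[cite: Deligne1982HodgeCycles, §2 Example 2.1 (c) (p. 16)] [cite: Andre1996Motifs, §1.1 (p. 10) and Prop. 2.5.1 (p. 18)] -/
theorem lefschetzInvolution_mem_span_absoluteHodge (hL : deligne1982_lefschetz_absoluteHodge_iff)
    (hX : IsSmoothProjective n X) (hη : IsPolarizationClass n X η) {e e' : ℕ} (hee' : 2 * e + 2 * e' = 2 * n)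
    {y : complexBetti X (2 * e)} (hy : y ∈ Submodule.span ℂ {c : complexBetti X (2 * e) | IsAbsoluteHodgeClass n X e c}) :
    lefschetzInvolution hη.hasHardLefschetz hee' y ∈
      Submodule.span ℂ {c : complexBetti X (2 * e') | IsAbsoluteHodgeClass n X e' c} := by
  induction hy using Submodule.span_induction with
  | mem c hmem =>
    exact Submodule.subset_span ((hL.lefschetzInvolution_iff hX hη (show e + e' = n by omega) c).1 hmem)
  | zero => rw [map_zero]; exact Submodule.zero_mem _
  | add c c' _ _ ihc ihc' => rw [map_add]; exact Submodule.add_mem _ ihc ihc'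
  | smul a c _ ihc => rw [map_smul]; exact Submodule.smul_mem _ _ ihc

/-- **One-star sandwiches `Lᵃ *_η Lᶜ x` of a class `x ∈ S^b(X)` lie in `S(X)`** (mod V-B3 + T1c + CS7).
[cite: Deligne1982HodgeCycles, §2 Example 2.1 (a), (c) (p. 16)] [cite: Andre1996Motifs, Prop. 2.2 Cor. 1–2 (p. 16)] -/
theorem sandwich_mem_span_absoluteHodge (hZ : deligne1982_cycleClass_absoluteHodge)
    (hL : deligne1982_lefschetz_absoluteHodge_iff) (hcup : deligne1982_cupProduct_absoluteHodge)
    (hX : IsSmoothProjective n X) (hη : IsPolarizationClass n X η) {b : ℕ} {x : complexBetti X (2 * b)}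
    (hx : x ∈ Submodule.span ℂ {c : complexBetti X (2 * b) | IsAbsoluteHodgeClass n X b c})
    (a c M M' : ℕ) {r : ℕ} (hc : 2 * b + 2 * c = M) (hMM' : M + M' = 2 * n) (ha : M' + 2 * a = 2 * r) :
    lefschetzPowTo η a M' (2 * r) ha (lefschetzInvolution hη.hasHardLefschetz hMM' (lefschetzPowTo η c (2 * b) M hc x)) ∈
      Submodule.span ℂ {c : complexBetti X (2 * r) | IsAbsoluteHodgeClass n X r c} := by
  obtain rfl : M = 2 * (b + c) := by omega
  obtain ⟨e, he⟩ : ∃ e, b + c + e = n := ⟨n - (b + c), by omega⟩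
  obtain rfl : M' = 2 * e := by omega
  obtain rfl : r = e + a := by omega
  have h1 := lefschetzPowTo_mem_span_absoluteHodge hZ hcup hX hη c b hc hx
  have h2 := lefschetzInvolution_mem_span_absoluteHodge hL hX hη hMM' h1
  exact lefschetzPowTo_mem_span_absoluteHodge hZ hcup hX hη a e ha h2

/-! ## §3 The Lefschetz components of a class of `S(X)` lie in `S(X)` (mod V-B3 + T1c + CS7) -/

/-- **The Lefschetz (primitive) components of a class of `S^b(X)` lie in `S(X)`** — Deligne–Milne's «`Λ`, `*`, `p^i`
are absolute Hodge cycles» at the level of classes; André's Prop. 2.2 Cor. 2 with «motivé» replaced by «de Hodge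
absolu». For `X` smooth projective of dimension `n`, a polarisation class `η`, `x ∈ S^b(X)` and a Lefschetz index
`(2q, k)` (`2q + 2k = 2b`), every `Lᵃ' ξ_{(2q,k)}(x)` (`a' = 0`: the primitive component itself) lies in `S(X)`: it is
in the span of the sandwiches `Lᵃ *_η Lᶜ x` (`lefschetzComponent_mem_sandwichSpan`, ring2-b05 gen 35), which lie in
`S(X)` (§2). [cite: DeligneMilne1982Tannakian, II Prop. 6.2 and 6.5] [cite: Andre1996Motifs, Prop. 2.2 Cor. 2 (p. 16)]
[cite: Kleiman1968AlgebraicCycles, §1.4 (1.4.1–1.4.4)] -/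
theorem lefschetzPowTo_primitivePart_mem_span_absoluteHodge (hZ : deligne1982_cycleClass_absoluteHodge)
    (hL : deligne1982_lefschetz_absoluteHodge_iff) (hcup : deligne1982_cupProduct_absoluteHodge)
    (hX : IsSmoothProjective n X) (hη : IsPolarizationClass n X η) {b : ℕ} {x : complexBetti X (2 * b)}
    (hx : x ∈ Submodule.span ℂ {c : complexBetti X (2 * b) | IsAbsoluteHodgeClass n X b c})
    (q k : ℕ) (hqk : 2 * q + 2 * k = 2 * b) (a' : ℕ) {r : ℕ} (hr : 2 * q + 2 * a' = 2 * r) :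
    lefschetzPowTo η a' (2 * q) (2 * r) hr
        (primitivePart η n hη.hasHardLefschetz (fun _ hm ↦ subsingleton_complexBetti hX hm) ⟨(2 * q, k), hqk⟩ x) ∈
      Submodule.span ℂ {c : complexBetti X (2 * r) | IsAbsoluteHodgeClass n X r c} := by
  classical
  have hvan : ∀ m, 2 * n < m → Subsingleton (complexBetti X m) := fun m hm ↦ subsingleton_complexBetti hX hm
  by_cases hlive : n < 2 * q + k
  · rw [primitivePart_of_lt hη.hasHardLefschetz hvan ⟨(2 * q, k), hqk⟩ hlive, LinearMap.zero_apply, map_zero]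
    exact Submodule.zero_mem _
  have hmem : (⟨(2 * q, k), hqk⟩ : {ik : ℕ × ℕ // ik.1 + 2 * ik.2 = 2 * b}) ∈
      Finset.univ.filter (fun ik : {ik : ℕ × ℕ // ik.1 + 2 * ik.2 = 2 * b} ↦ ik.1.1 + ik.1.2 ≤ n) :=
    Finset.mem_filter.2 ⟨Finset.mem_univ _, by simpa using not_lt.1 hlive⟩
  have hdec : x = ∑ ik ∈ Finset.univ.filter (fun ik : {ik : ℕ × ℕ // ik.1 + 2 * ik.2 = 2 * b} ↦ ik.1.1 + ik.1.2 ≤ n),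
      lefschetzPowTo η ik.1.2 ik.1.1 (2 * b) ik.2 (primitivePart η n hη.hasHardLefschetz hvan ik x) := by
    rw [Finset.sum_filter]
    conv_lhs => rw [← sum_lefschetzPowTo_primitivePart hη.hasHardLefschetz hvan x]
    refine Finset.sum_congr rfl fun ik _ ↦ ?_
    split_ifs with h
    · rfl
    · rw [primitivePart_of_lt hη.hasHardLefschetz hvan ik (not_le.1 h), LinearMap.zero_apply, map_zero]
  have hspan := lefschetzComponent_mem_sandwichSpan hη.hasHardLefschetz _ _
    (fun ik ↦ primitivePart_mem hη.hasHardLefschetz hvan ik x) (fun ik hik ↦ (Finset.mem_filter.1 hik).2) hdec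
    hmem a' hr
  refine (Submodule.span_le.2 ?_) hspan
  rintro z ⟨a, c, M, M', hc, hMM', ha, rfl⟩
  exact sandwich_mem_span_absoluteHodge hZ hL hcup hX hη hx a c M M' hc hMM' ha

/-! ## §4 Non-degeneracy of the cup pairing on `S^p(X) × S^q(X)`, `p + q = n` (mod V-B3 + T1c + CS7) -/

/-- **LEFT NON-DEGENERACY OF THE CUP PAIRING ON ABSOLUTE HODGE CLASSES** (Deligne–Milne II Prop. 6.5 at the level of
realisations; André's Prop. 3.3 with «motivé» ↦ «de Hodge absolu»), modulo V-B3 + T1c + CS7. For `X` smooth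
projective of dimension `n`, `p + q = n` and `ξ ∈ S^p(X)`: if `ξ ∪ h = 0` for every `h ∈ S^q(X)`, then `ξ = 0`.
Proof (André's, on the real carriers, as ring2-b05 gen 36): with a Kähler–rational datum `D` (Kähler class a
polarisation class) and `x = conj ξ ∈ S^p` (§1), `Q_D(x, ·) = τ(z ∪ ·)` for `z = Σ_P ± L^{n-a-t} ξ_P x`
(`Ring2.AbelianAll.exists_polarizationForm_eq_trace_cupProduct`), which lies in `S^q` by §3; so
`Q_D(x, conj x) = ± τ(ξ ∪ z) = 0`, and `x = 0` by the second Hodge–Riemann relation on pure type `(p,p)`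
(`KaehlerRationalDatum.cform_conj_pos`; `S^p ⊆` Hodge span, §1). [cite: DeligneMilne1982Tannakian, II Prop. 6.2 and 6.5]
[cite: Andre1996Motifs, Prop. 3.3 (pp. 21–22)] [cite: VoisinHodgeI2002, §6.3.2 Thm. 6.32 and §7.1.2] -/
theorem eq_zero_of_forall_cupProduct_absoluteHodge_eq_zero (hZ : deligne1982_cycleClass_absoluteHodge)
    (hL : deligne1982_lefschetz_absoluteHodge_iff) (hcup : deligne1982_cupProduct_absoluteHodge)
    (hX : IsSmoothProjective n X) {p q : ℕ} (hpq : p + q = n) {ξ : complexBetti X (2 * p)}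
    (hξ : ξ ∈ Submodule.span ℂ {c : complexBetti X (2 * p) | IsAbsoluteHodgeClass n X p c})
    (h : ∀ h ∈ Submodule.span ℂ {c : complexBetti X (2 * q) | IsAbsoluteHodgeClass n X q c},
      cupProduct (show 2 * p + 2 * q = 2 * n by omega) ξ h = 0) :
    ξ = 0 := by
  obtain ⟨D⟩ := nonempty_kaehlerRationalDatum hX
  obtain ⟨A⟩ := nonempty_hodgeModel_holds hX
  have hη : IsPolarizationClass n X D.Hη := Ring2.AbelianAll.isPolarizationClass_Hη hX D
  set x := conjClass (ComplexPoints X) (2 * p) ξ with hxdef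
  have hx : x ∈ Submodule.span ℂ {c : complexBetti X (2 * p) | IsAbsoluteHodgeClass n X p c} :=
    conjClass_mem_span_absoluteHodge p hξ
  -- `Q_D(x, ·) = τ(z ∪ ·)` with `z ∈ S^q` (§3)
  obtain ⟨z, hz, hQ⟩ := Ring2.AbelianAll.exists_polarizationForm_eq_trace_cupProduct (D.hLℂ hX)
    (subsingleton_of_lt hX ℂ) (D.cTrace hX) (show 2 * q + 2 * p = 2 * n by omega) x
    (Submodule.span ℂ {c : complexBetti X (2 * q) | IsAbsoluteHodgeClass n X q c})
    (fun P s' hs' hq' ↦ by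
      obtain ⟨⟨a, t⟩, hP⟩ := P
      dsimp only at hs' hq' ⊢
      obtain ⟨q₁, rfl⟩ : ∃ q₁, a = 2 * q₁ := ⟨p - t, by omega⟩
      exact lefschetzPowTo_primitivePart_mem_span_absoluteHodge hZ hL hcup hX hη hx q₁ t hP s' hq')
  -- `Q_D(x, conj x) = τ(z ∪ ξ) = ± τ(ξ ∪ z) = 0`
  have h0 : D.cform hX (2 * p) x (conjClass (ComplexPoints X) (2 * p) x) = 0 := by
    rw [hxdef, conjClass_conjClass ξ, ← hxdef, KaehlerRationalDatum.cform, hQ,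
      cupProduct_gradedComm_holds ℂ (ComplexPoints X) (show 2 * q + 2 * p = 2 * n by omega)
        (show 2 * p + 2 * q = 2 * n by omega) z ξ, h z hz, smul_zero, map_zero]
  -- Hodge–Riemann: `x = 0`
  by_contra hξ0
  have hx0 : x ≠ 0 := by
    intro hx0
    apply hξ0
    rw [← conjClass_conjClass ξ, ← hxdef, hx0, conjClass_zero]
  have hpp : (p, p) ∈ Finset.HasAntidiagonal.antidiagonal (2 * p) := Finset.HasAntidiagonal.mem_antidiagonal.2 (by omega)
  have hxA : x ∈ A.typePiece (2 * p) ⟨(p, p), hpp⟩ :=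
    Ring2.AbelianAll.span_hodge_le_typePiece hX A p hpp (span_absoluteHodge_le_span_hodge p hx)
  obtain ⟨r, hr, hQr⟩ := D.cform_conj_pos hX A hpp hxA hx0
  rw [h0, mul_zero] at hQr
  exact hr.ne' (by exact_mod_cast hQr.symm)

/-- **RIGHT NON-DEGENERACY** (the same with `p`, `q` exchanged; graded commutativity in even degrees).
[cite: DeligneMilne1982Tannakian, II Prop. 6.5] [cite: Andre1996Motifs, Prop. 3.3 (pp. 21–22)] -/
theorem eq_zero_of_forall_cupProduct_absoluteHodge_eq_zero' (hZ : deligne1982_cycleClass_absoluteHodge)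
    (hL : deligne1982_lefschetz_absoluteHodge_iff) (hcup : deligne1982_cupProduct_absoluteHodge)
    (hX : IsSmoothProjective n X) {p q : ℕ} (hpq : p + q = n) {h : complexBetti X (2 * q)}
    (hh : h ∈ Submodule.span ℂ {c : complexBetti X (2 * q) | IsAbsoluteHodgeClass n X q c})
    (h0 : ∀ ξ ∈ Submodule.span ℂ {c : complexBetti X (2 * p) | IsAbsoluteHodgeClass n X p c},
      cupProduct (show 2 * p + 2 * q = 2 * n by omega) ξ h = 0) :
    h = 0 := by
  refine eq_zero_of_forall_cupProduct_absoluteHodge_eq_zero hZ hL hcup hX (show q + p = n by omega) hh fun ξ hξ ↦ ?_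
  rw [cupProduct_gradedComm_holds ℂ (ComplexPoints X) (show 2 * q + 2 * p = 2 * n by omega)
    (show 2 * p + 2 * q = 2 * n by omega) h ξ, h0 ξ hξ, smul_zero]

/-- **DELIGNE–MILNE II PROP. 6.5 ON THE REAL CARRIERS, packaged** (mod V-B3 + T1c + CS7): for every smooth projective
complex `X` of dimension `n` and `p + q = n`, the cup product pairing `S^p(X) × S^q(X) → H^{2n}(X(ℂ); ℂ)` on the
`ℂ`-spans of the absolute Hodge classes is non-degenerate on both sides — numerical and homological equivalence agree
on absolute Hodge classes. (Motivated twin: ring2-b05's `nondegenerate_motivatedClasses`, unconditional; algebraic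
twin: Grothendieck's `D(X)`, open.) [cite: DeligneMilne1982Tannakian, II Prop. 6.5] [cite: Andre1996Motifs, Prop. 3.3 (pp. 21–22)]
[cite: Grothendieck1968, §3 p. 196] -/
theorem nondegenerate_span_absoluteHodge (hZ : deligne1982_cycleClass_absoluteHodge)
    (hL : deligne1982_lefschetz_absoluteHodge_iff) (hcup : deligne1982_cupProduct_absoluteHodge)
    (hX : IsSmoothProjective n X) {p q : ℕ} (hpq : p + q = n) :
    (∀ ξ ∈ Submodule.span ℂ {c : complexBetti X (2 * p) | IsAbsoluteHodgeClass n X p c},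
        (∀ b ∈ Submodule.span ℂ {c : complexBetti X (2 * q) | IsAbsoluteHodgeClass n X q c},
          cupProduct (show 2 * p + 2 * q = 2 * n by omega) ξ b = 0) → ξ = 0) ∧
      (∀ b ∈ Submodule.span ℂ {c : complexBetti X (2 * q) | IsAbsoluteHodgeClass n X q c},
        (∀ ξ ∈ Submodule.span ℂ {c : complexBetti X (2 * p) | IsAbsoluteHodgeClass n X p c},
          cupProduct (show 2 * p + 2 * q = 2 * n by omega) ξ b = 0) → b = 0) :=
  ⟨fun _ hξ hb ↦ eq_zero_of_forall_cupProduct_absoluteHodge_eq_zero hZ hL hcup hX hpq hξ hb,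
    fun _ hb hξ ↦ eq_zero_of_forall_cupProduct_absoluteHodge_eq_zero' hZ hL hcup hX hpq hb hξ⟩

/-- **Generator form: an ABSOLUTE HODGE class cup-orthogonal to all ABSOLUTE HODGE classes of the complementary
codimension is zero** (mod V-B3 + T1c + CS7) — «numerical equivalence is equality on absolute Hodge classes».
Orthogonality to the generators gives orthogonality to their span by linearity. [cite: DeligneMilne1982Tannakian, II Prop. 6.5]
[cite: Andre1996Motifs, Prop. 3.3 (pp. 21–22)] -/
theorem eq_zero_of_forall_cupProduct_isAbsoluteHodgeClass_eq_zero (hZ : deligne1982_cycleClass_absoluteHodge)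
    (hL : deligne1982_lefschetz_absoluteHodge_iff) (hcup : deligne1982_cupProduct_absoluteHodge)
    (hX : IsSmoothProjective n X) {p q : ℕ} (hpq : p + q = n) {ξ : complexBetti X (2 * p)}
    (hξ : IsAbsoluteHodgeClass n X p ξ)
    (h : ∀ h : complexBetti X (2 * q), IsAbsoluteHodgeClass n X q h →
      cupProduct (show 2 * p + 2 * q = 2 * n by omega) ξ h = 0) :
    ξ = 0 := by
  refine eq_zero_of_forall_cupProduct_absoluteHodge_eq_zero hZ hL hcup hX hpq (Submodule.subset_span hξ) fun b hb ↦ ?_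
  induction hb using Submodule.span_induction with
  | mem c hmem => exact h c hmem
  | zero => rw [map_zero]
  | add c c' _ _ ihc ihc' => rw [map_add, ihc, ihc', add_zero]
  | smul a c _ ihc => rw [map_smul, ihc, smul_zero]

end Summit.HodgeConjecture.HodgeConjecture.Ring2.Hypotheses

end
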